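import Mathlib
import Summits.NavierStokesRegularity.NavierStokesRegularity.Theorems.TypeIQuarterGateScarEnvelopeTypeIZoomDictionaryDefs
import Summits.NavierStokesRegularity.NavierStokesRegularity.Theorems.TypeIQuarterGateScarEnvelopeTypeIFatKill
import Summits.NavierStokesRegularity.NavierStokesRegularity.Theorems.TypeIQuarterGateScarEnvelopeTypeIBudgetViolators
import Summits.NavierStokesRegularity.NavierStokesRegularity.Theorems.TypeIQuarterGateScarEnvelopeTypeIOfNoTwinScarObject
import Summits.NavierStokesRegularity.NavierStokesRegularity.Theorems.TypeIQuarterGateQuarterLawTypeIGlue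
import Summits.NavierStokesRegularity.NavierStokesRegularity.Theorems.TypeIQuarterGateEnvelopeQuarterLaw
import Summits.NavierStokesRegularity.NavierStokesRegularity.Theorems.TypeIQuarterGateScarEnvelopeTypeINearOneRateDss
import Literature.Analysis.FluidPDE.AncientAxisymmetricTypeILiouville
import Summits.NavierStokesRegularity.NavierStokesRegularity.Theorems.TypeIQuarterGateScarEnvelopeTypeIZoomDictionaryLemmas
import Summits.NavierStokesRegularity.NavierStokesRegularity.Theorems.TypeIQuarterGateScarEnvelopeTypeISatelliteTowerDefs
import Summits.NavierStokesRegularity.NavierStokesRegularity.Theorems.TypeIQuarterGateScarEnvelopeTypeISatelliteTowerObjects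
import Summits.NavierStokesRegularity.NavierStokesRegularity.Theorems.TypeIQuarterGateScarEnvelopeTypeISatelliteTowerClosure
import Summits.NavierStokesRegularity.NavierStokesRegularity.Theorems.TypeIQuarterGateScarEnvelopeTypeISatelliteTowerEnvelopeStability

/-!
# Part L3–L4: TAME ⇒ ENVELOPED, and the envelope passes to tangent flows globally

Part L3–L4 of the ROUND-32 plate: in the tower frame a TAME node is ENVELOPED (`ABTower.hasTypeIDecay_of_budgetAt`-type statements), and K8 re-run with the envelope carried: tangent flows of enveloped A–B objects are enveloped A–B objects.

PROVENANCE: declaration texts VERBATIM from the HOME plates of the instrument seat nsreg-p3 (g24/g25, cell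
`pub/ns-regularity-ideate`): `round-31/Tangent31prep.lean` v5 (sha16 `e5b8668e3a090216`; = ROUND-30 plate v10 + Part K) and,
for Part L, `round-32/Tangent32prep.lean` v6 (sha16 `6123f27718636121`);
the author cannot write under `Theorems/` (`perm.theorems-prover-only`); landed by the
LEAD-lineage prover ns-sz-p1 g5 on director-ns DIRECTOR-NS #218 (2), split into ≤ 400-line modules (the
plate's `def`s gathered in `TypeIQuarterGateScarEnvelopeTypeIZoomDictionaryDefs`), namespace
`Summit.NavierStokesRegularity.NavierStokesRegularity.Cruxes.ScarEnvelopeTypeI.ZoomDictionary` (the plate's `NsregP3.R30P`), `E3` spelled out, one-line docstrings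
added where the plate had none.  `--supports stmt-NavierStokesRegularity-23843 --as helper`.

HONEST FRAMING: dictionary / census TOOLING for the crux `TypeIQuarterGate.ScarEnvelopeTypeI` (item 23843):
equivalences and normal forms, kernel-checked; NO open statement is proved — 23843, its parent
`QuarterLawTypeI` (23726), the route and Navier–Stokes regularity are OPEN; hard core evaded: none.
-/

-- the summit-side namespace repeats a component by design (single-conjunct summit, D-0017)
set_option linter.dupNamespace false

open MeasureTheory Set Metric Filter Topology
open scoped ENNReal

namespace Summit.NavierStokesRegularity.NavierStokesRegularity.Cruxes.ScarEnvelopeTypeI.ZoomDictionary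

variable {u : ℝ → (EuclideanSpace ℝ (Fin 3)) → (EuclideanSpace ℝ (Fin 3))} {a : (EuclideanSpace ℝ (Fin 3))} {ν T : ℝ}

section Tower

open Literature.Analysis.FluidPDE
variable {U : ℝ → (EuclideanSpace ℝ (Fin 3)) → (EuclideanSpace ℝ (Fin 3))} {P : ℝ → (EuclideanSpace ℝ (Fin 3)) → ℝ} {y' : (EuclideanSpace ℝ (Fin 3))} {ν : ℝ}
open Summit.NavierStokesRegularity.NavierStokesRegularity.Cruxes.ScarEnvelopeTypeI.ScarZoom
  (CruxHypotheses ScarViolators TwinScarObject singularAt_of_isBackwardSingularPoint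
    exists_localEnergy_of_typeIBound) in

/-! #### L3. Tower frame: TAME ⇒ ENVELOPED -/

/-- **A TAME point of a tower object is an ENVELOPED point.**  For `TowerObj M U P` and a final-time
point `y'` where the slice budget `BudgetAt 1 0 U y'` holds, `U` obeys the KNSS space–time Type-I
envelope on a backward neighbourhood of `(0, y')`:
`‖U(t,x)‖ ≤ A/(‖x − y'‖ + √(−t))`, `t ∈ (−δ², 0)`, `x ∈ B(y', δ)`. -/
theorem TowerObj.envelope_of_budgetAt {M : ℝ} (h : TowerObj M U P) {y' : (EuclideanSpace ℝ (Fin 3))}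
    (hb : BudgetAt 1 0 U y') :
    ∃ A δ : ℝ, 0 < δ ∧ ∀ t ∈ Ioo (-(δ ^ 2)) 0, ∀ x ∈ ball y' δ,
      ‖U t x‖ ≤ A / (‖x - y'‖ + Real.sqrt (-t)) := by
  obtain ⟨hc, -, hZ, hB⟩ := h.inputs y'
  have hdec : HasTypeITimeDecay M U := h.2.2.1
  have hrate : ∀ t ∈ Ioo ((1 : ℝ) - 1) 1, ∀ x, Real.sqrt (1 - t) * ‖tshift U t x‖ ≤ M := by
    intro t ht x
    have ht' : t - 1 < 0 := by linarith [ht.2]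
    have h1 := hdec (t - 1) ht' x
    have hs : 0 < Real.sqrt (-(t - 1)) := Real.sqrt_pos.2 (by linarith)
    rw [tshift_apply, show (1 : ℝ) - t = -(t - 1) by ring]
    rwa [le_div_iff₀ hs, mul_comm] at h1
  have hN : ∀ L ū, TangentU (tshift U) (tshift P) y' 1 L ū →
      ∀ z : (EuclideanSpace ℝ (Fin 3)), z ≠ 0 → ‖z‖ < 1 → RegPt ū z :=
    fun L ū hL => (towerDictionary_inBall h y').1 hb L ū (tangentU_tshift_iff.1 hL)
  obtain ⟨A, δ, hδ, hAδ⟩ := envelope_of_noSatellite one_pos hc one_pos hrate hZ hB hN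
  refine ⟨A, δ, hδ, fun t ht x hx => ?_⟩
  have h1 := hAδ (t + 1) ⟨by linarith [ht.1], by linarith [ht.2]⟩ x hx
  rwa [tshift_apply, add_sub_cancel_right, show (1 : ℝ) - (t + 1) = -t by ring] at h1

/-! #### L4. The envelope passes to the tangent flows GLOBALLY (K8 with the envelope carried) -/

/-- **Enveloped points have enveloped tangent flows, globally.**  For `(U, P, H)` in the engine class,
a tangent flow `Ū` of `U` at `(0, y')` and the local space–time envelope of `U` at `(0, y')`, the
A–B representative `U'` of `Ū` (K8) obeys `HasTypeIDecay A U'` on the WHOLE open past: the zooms obey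
the scale-invariant envelope on `Q(0, 2ᵐ)` eventually, the bound passes to the `L³` limit a.e. and to
the continuous Oseen-mild representative everywhere. -/
theorem abTower_closed_decay {M : ℝ} {H : ℝ → (EuclideanSpace ℝ (Fin 3)) → (EuclideanSpace ℝ (Fin 3)) →L[ℝ] (EuclideanSpace ℝ (Fin 3))} (h : ABTower M U P H) {y' : (EuclideanSpace ℝ (Fin 3))}
    {L : ℕ → ℝ} {Ū : ℝ → (EuclideanSpace ℝ (Fin 3)) → (EuclideanSpace ℝ (Fin 3))} (ht : TangentU U P y' 0 L Ū) {A δ : ℝ} (hδ : 0 < δ)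
    (henv : ∀ t ∈ Ioo (-(δ ^ 2)) 0, ∀ x ∈ ball y' δ, ‖U t x‖ ≤ A / (‖x - y'‖ + Real.sqrt (-t))) :
    ∃ (U' : ℝ → (EuclideanSpace ℝ (Fin 3)) → (EuclideanSpace ℝ (Fin 3))) (P' : ℝ → (EuclideanSpace ℝ (Fin 3)) → ℝ) (H' : ℝ → (EuclideanSpace ℝ (Fin 3)) → (EuclideanSpace ℝ (Fin 3)) →L[ℝ] (EuclideanSpace ℝ (Fin 3))), ABTower M U' P' H' ∧
      HasTypeIDecay A U' ∧
      ∀ R ∈ Ioo (0 : ℝ) 1, ∀ᵐ z ∂(volume.restrict (parabolicCylinder R (0 : ℝ × (EuclideanSpace ℝ (Fin 3))))),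
        Ū z.1 z.2 = U' z.1 z.2 := by
  obtain ⟨hmild, hIB, hH, hI⟩ := h
  obtain ⟨hL, hL0, pbar, hTR⟩ := ht
  have hdec : HasTypeITimeDecay M U := hmild.2.2.2
  have hM : 0 ≤ M := by
    have h := hdec (-1) (by norm_num) 0
    rw [neg_neg, Real.sqrt_one, div_one] at h
    exact (norm_nonneg _).trans h
  have hcc_pos : ∀ m : ℕ, (0 : ℝ) < (2 : ℝ) ^ m := fun m => by positivity
  set I₀ : ℝ≥0∞ := typeIBound (Iio (0 : ℝ) ×ˢ univ) U P H with hI₀def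
  set z₀ : ℝ × (EuclideanSpace ℝ (Fin 3)) := ((0 : ℝ), y') with hz₀def
  have hz1 : z₀.1 = 0 := by rw [hz₀def]
  have hz2 : z₀.2 = y' := by rw [hz₀def]
  have hz₀sub : ∀ ρ : ℝ, parabolicCylinder ρ z₀ ⊆ Iio (0 : ℝ) ×ˢ (univ : Set (EuclideanSpace ℝ (Fin 3))) := fun ρ =>
    parabolicCylinder_subset_lowerHalf ρ y'
  have hQsl : ∀ ρ : ℝ, (parabolicCylinderOpens ρ z₀ : TopologicalSpace.Opens (ℝ × (EuclideanSpace ℝ (Fin 3)))) ≤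
      slab (EuclideanSpace ℝ (Fin 3)) (Iio 0) isOpen_Iio := fun ρ w hw => hz₀sub ρ hw
  -- ## the zoomed triples
  set v : ℕ → ℝ → (EuclideanSpace ℝ (Fin 3)) → (EuclideanSpace ℝ (Fin 3)) := fun k => L k • stPull (L k ^ 2) (L k) z₀.1 z₀.2 U with hvdef
  set q : ℕ → ℝ → (EuclideanSpace ℝ (Fin 3)) → ℝ := fun k => L k ^ 2 • stPull (L k ^ 2) (L k) z₀.1 z₀.2 P with hqdef
  set Gz : ℕ → ℝ → (EuclideanSpace ℝ (Fin 3)) → (EuclideanSpace ℝ (Fin 3)) →L[ℝ] (EuclideanSpace ℝ (Fin 3)) :=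
    fun k => L k ^ 2 • stPull (L k ^ 2) (L k) z₀.1 z₀.2 H with hGzdef
  -- the class on every `Q(0, 2ᵐ)`
  have hballs : ∀ m k : ℕ, IsSuitableWeakSolutionInBall ((2 : ℝ) ^ m) 0 (v k) (q k) := by
    intro m k
    set ρ : ℝ := (2 : ℝ) ^ m * L k with hρ
    have hρ0 : 0 < ρ := mul_pos (hcc_pos m) (hL k)
    have hsub : parabolicCylinder ρ z₀ ⊆ parabolicCylinder (‖y'‖ + ρ) (0 : ℝ × (EuclideanSpace ℝ (Fin 3))) :=
      parabolicCylinder_subset_zero (pow_le_pow_left₀ hρ0.le (by linarith [norm_nonneg y']) 2)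
        le_rfl
    have h0 : IsSuitableWeakSolutionInBall ρ z₀ U P :=
      (hIB (‖y'‖ + ρ) (by positivity)).of_subset_zero (z := z₀) hρ0 hsub
    have h1 := h0.zoom hρ0
    set c : ℝ := L k / ρ with hc
    have hc0 : 0 < c := div_pos (hL k) hρ0
    have h2 := h1.zoomOut hc0
    have hcρ : c * ρ = L k := div_mul_cancel₀ _ hρ0.ne'
    have hrad : 1 / c = (2 : ℝ) ^ m := by
      rw [hc, one_div_div, hρ, mul_div_cancel_right₀ _ (hL k).ne']
    rw [zoom_zoom, zoom_zoom, hcρ, hrad, show c ^ 2 * ρ ^ 2 = L k ^ 2 by rw [← hcρ]; ring] at h2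
    exact h2
  -- the weak gradients
  have hgrads : ∀ m k : ℕ,
      HasWeakSpatialGradientOn (parabolicCylinderOpens ((2 : ℝ) ^ m) (0 : ℝ × (EuclideanSpace ℝ (Fin 3)))) (v k) (Gz k) := by
    intro m k
    set ρ : ℝ := (2 : ℝ) ^ m * L k with hρ
    have hρL : ρ / L k = (2 : ℝ) ^ m := by rw [hρ, mul_div_cancel_right₀ _ (hL k).ne']
    have h1 := (hH.mono (hQsl ρ)).stRescale (L k) (β := L k ^ 2) (γ := L k) (pow_pos (hL k) 2)
      (hL k) z₀.1 z₀.2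
    have hpre : stPreimage (L k ^ 2) (L k) z₀.1 z₀.2 (parabolicCylinderOpens ρ z₀) =
        parabolicCylinderOpens ((2 : ℝ) ^ m) (0 : ℝ × (EuclideanSpace ℝ (Fin 3))) := by
      refine TopologicalSpace.Opens.ext ?_
      have e := zoom_preimage_parabolicCylinder (hL k) z₀ ρ
      rw [hρL] at e
      exact e
    rw [show L k * L k = L k ^ 2 by ring, hpre] at h1
    exact h1
  -- the Type I bound
  have hIs : ∀ m k : ℕ,
      typeIBound (parabolicCylinder ((2 : ℝ) ^ m) (0 : ℝ × (EuclideanSpace ℝ (Fin 3)))) (v k) (q k) (Gz k) ≤ I₀ := by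
    intro m k
    set ρ : ℝ := (2 : ℝ) ^ m * L k with hρ
    have hρL : ρ / L k = (2 : ℝ) ^ m := by rw [hρ, mul_div_cancel_right₀ _ (hL k).ne']
    refine le_trans ?_ (typeIBound_mono (hz₀sub ρ))
    rw [← typeIBound_nsZoom (hL k) z₀.1 z₀.2 (parabolicCylinder ρ z₀) U P H,
      zoom_preimage_parabolicCylinder (hL k) z₀ ρ, hρL]
  -- ## compactness with the class on all balls (tree)
  obtain ⟨Ut, Pt, Ht, σ, hσ, hIBU, hswU, hHU, h4I, hmemU, hconvU, -⟩ :=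
    Summit.NavierStokesRegularity.NavierStokesRegularity.Cruxes.ScarEnvelopeTypeI.SliceBudget.local_typeI_compactness_twin_inBall
      I₀ v q Gz hI (fun m k _ => hballs m k) (fun m k _ => hgrads m k) (fun m k _ => hIs m k)
  have h4Itop : typeIBound (Iio (0 : ℝ) ×ˢ univ) Ut Pt Ht < ⊤ :=
    lt_of_le_of_lt h4I (ENNReal.mul_lt_top (by simp) hI)
  -- ## the rate: on the zooms everywhere, on the limit a.e.
  have hratev : ∀ (k : ℕ) (s : ℝ) (y : (EuclideanSpace ℝ (Fin 3))), s < 0 → ‖v k s y‖ ≤ M / Real.sqrt (-s) := by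
    intro k s y hs
    have hL2 : 0 < L k ^ 2 := pow_pos (hL k) 2
    have hL2s : L k ^ 2 * s < 0 := mul_neg_of_pos_of_neg hL2 hs
    have h := hdec _ hL2s (y' + L k • y)
    have hsq : Real.sqrt (-(L k ^ 2 * s)) = L k * Real.sqrt (-s) := by
      rw [show -(L k ^ 2 * s) = L k ^ 2 * (-s) by ring, Real.sqrt_mul (sq_nonneg _),
        Real.sqrt_sq (hL k).le]
    rw [hsq] at h
    have hspos : 0 < Real.sqrt (-s) := Real.sqrt_pos.2 (by linarith)
    show ‖(L k • stPull (L k ^ 2) (L k) z₀.1 z₀.2 U) s y‖ ≤ M / Real.sqrt (-s)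
    rw [smul_stPull_apply, hz1, hz2, zero_add, norm_smul, Real.norm_of_nonneg (hL k).le,
      le_div_iff₀ hspos]
    have h' := (le_div_iff₀ (mul_pos (hL k) hspos)).1 h
    calc L k * ‖U (L k ^ 2 * s) (y' + L k • y)‖ * Real.sqrt (-s)
        = ‖U (L k ^ 2 * s) (y' + L k • y)‖ * (L k * Real.sqrt (-s)) := by ring
      _ ≤ M := h'
  -- ## the envelope: on the zooms eventually on every `Q(0, 2ᵐ)`
  have henvv : ∀ m : ℕ, ∀ᶠ k in atTop, ∀ w ∈ parabolicCylinder ((2 : ℝ) ^ m) (0 : ℝ × (EuclideanSpace ℝ (Fin 3))),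
      ‖v k w.1 w.2‖ ≤ A / (‖w.2‖ + Real.sqrt (-w.1)) := by
    intro m
    have hsmall : ∀ᶠ k in atTop, (2 : ℝ) ^ m * L k < δ := by
      have h1 := hL0.const_mul ((2 : ℝ) ^ m)
      rw [mul_zero] at h1
      exact h1.eventually_mem (Iio_mem_nhds hδ)
    filter_upwards [hsmall] with k hk
    rintro ⟨s, y⟩ hw
    rw [mem_parabolicCylinder] at hw
    obtain ⟨⟨hs1, hs2⟩, hy⟩ := hw
    simp only [Prod.fst_zero, Prod.snd_zero, zero_sub, dist_zero_right] at hs1 hs2 hy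
    have hL2 : 0 < L k ^ 2 := pow_pos (hL k) 2
    have h2m : 0 ≤ (2 : ℝ) ^ m * L k := (mul_pos (pow_pos two_pos m) (hL k)).le
    have hsqδ : ((2 : ℝ) ^ m * L k) ^ 2 < δ ^ 2 := pow_lt_pow_left₀ hk h2m two_ne_zero
    have hts : L k ^ 2 * s ∈ Ioo (-(δ ^ 2)) 0 := by
      refine ⟨?_, mul_neg_of_pos_of_neg hL2 hs2⟩
      nlinarith [hs1, hL2, hsqδ]
    have hxy : y' + L k • y ∈ ball y' δ := by
      rw [mem_ball, dist_eq_norm, add_sub_cancel_left, norm_smul, Real.norm_of_nonneg (hL k).le]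
      calc L k * ‖y‖ ≤ L k * (2 : ℝ) ^ m := mul_le_mul_of_nonneg_left hy.le (hL k).le
        _ = (2 : ℝ) ^ m * L k := mul_comm _ _
        _ < δ := hk
    have h := henv _ hts _ hxy
    have hsq : Real.sqrt (-(L k ^ 2 * s)) = L k * Real.sqrt (-s) := by
      rw [show -(L k ^ 2 * s) = L k ^ 2 * (-s) by ring, Real.sqrt_mul (sq_nonneg _),
        Real.sqrt_sq (hL k).le]
    rw [add_sub_cancel_left, norm_smul, Real.norm_of_nonneg (hL k).le, hsq, ← mul_add] at h
    have hden : 0 < ‖y‖ + Real.sqrt (-s) :=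
      add_pos_of_nonneg_of_pos (norm_nonneg _) (Real.sqrt_pos.2 (by linarith))
    show ‖(L k • stPull (L k ^ 2) (L k) z₀.1 z₀.2 U) s y‖ ≤ A / (‖y‖ + Real.sqrt (-s))
    rw [smul_stPull_apply, hz1, hz2, zero_add, norm_smul, Real.norm_of_nonneg (hL k).le]
    calc L k * ‖U (L k ^ 2 * s) (y' + L k • y)‖
        ≤ L k * (A / (L k * (‖y‖ + Real.sqrt (-s)))) := mul_le_mul_of_nonneg_left h (hL k).le
      _ = A / (‖y‖ + Real.sqrt (-s)) := by
          rw [← mul_div_assoc, mul_div_mul_left _ _ (hL k).ne']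
  have hrate_ae : ∀ᵐ w ∂(volume.restrict (Iio (0 : ℝ) ×ˢ (univ : Set (EuclideanSpace ℝ (Fin 3))))),
      ‖Ut w.1 w.2‖ ≤ M / Real.sqrt (-w.1) := by
    have hQ : ∀ m : ℕ, ∀ᵐ w ∂(volume.restrict (parabolicCylinder ((2 : ℝ) ^ m) (0 : ℝ × (EuclideanSpace ℝ (Fin 3))))),
        ‖Ut w.1 w.2‖ ≤ M / Real.sqrt (-w.1) := by
      intro m
      have hmeas : ∀ j, AEStronglyMeasurable (Function.uncurry (v (σ j)))
          (volume.restrict (parabolicCylinder ((2 : ℝ) ^ m) (0 : ℝ × (EuclideanSpace ℝ (Fin 3))))) := fun j =>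
        (hballs m (σ j)).1.distributional.1.aestronglyMeasurable
      obtain ⟨ψ, -, hae⟩ := exists_subseq_tendsto_ae₃ hmeas (hmemU _ (hcc_pos m)).1
        (hconvU _ (hcc_pos m))
      filter_upwards [hae, ae_restrict_mem (isOpen_parabolicCylinder _ _).measurableSet]
        with w hw hwmem
      refine le_of_tendsto hw.norm (Eventually.of_forall fun i => ?_)
      have hw0 : w.1 < 0 := by
        have h1 := ((mem_parabolicCylinder).1 hwmem).1.2
        simpa using h1
      exact hratev _ w.1 w.2 hw0
    have hcover : (Iio (0 : ℝ) ×ˢ (univ : Set (EuclideanSpace ℝ (Fin 3)))) ⊆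
        ⋃ m : ℕ, parabolicCylinder ((2 : ℝ) ^ m) (0 : ℝ × (EuclideanSpace ℝ (Fin 3))) := by
      rintro ⟨t, x⟩ ⟨ht', -⟩
      obtain ⟨m, hm⟩ := exists_mem_parabolicCylinder_two_pow₃ (mem_Iio.1 ht') x
      exact mem_iUnion.2 ⟨m, hm⟩
    exact ae_restrict_of_ae_restrict_of_subset hcover ((ae_restrict_iUnion_iff _ _).2 hQ)
  have henv_ae : ∀ᵐ w ∂(volume.restrict (Iio (0 : ℝ) ×ˢ (univ : Set (EuclideanSpace ℝ (Fin 3))))),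
      ‖Ut w.1 w.2‖ ≤ A / (‖w.2‖ + Real.sqrt (-w.1)) := by
    have hQ : ∀ m : ℕ, ∀ᵐ w ∂(volume.restrict (parabolicCylinder ((2 : ℝ) ^ m) (0 : ℝ × (EuclideanSpace ℝ (Fin 3))))),
        ‖Ut w.1 w.2‖ ≤ A / (‖w.2‖ + Real.sqrt (-w.1)) := by
      intro m
      have hmeas : ∀ j, AEStronglyMeasurable (Function.uncurry (v (σ j)))
          (volume.restrict (parabolicCylinder ((2 : ℝ) ^ m) (0 : ℝ × (EuclideanSpace ℝ (Fin 3))))) := fun j =>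
        (hballs m (σ j)).1.distributional.1.aestronglyMeasurable
      obtain ⟨ψ, hψ, hae⟩ := exists_subseq_tendsto_ae₃ hmeas (hmemU _ (hcc_pos m)).1
        (hconvU _ (hcc_pos m))
      have hev' : ∀ᶠ i in atTop, ∀ w ∈ parabolicCylinder ((2 : ℝ) ^ m) (0 : ℝ × (EuclideanSpace ℝ (Fin 3))),
          ‖v (σ (ψ i)) w.1 w.2‖ ≤ A / (‖w.2‖ + Real.sqrt (-w.1)) :=
        (hσ.tendsto_atTop.comp hψ.tendsto_atTop).eventually (henvv m)
      filter_upwards [hae, ae_restrict_mem (isOpen_parabolicCylinder _ _).measurableSet]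
        with w hw hwmem
      refine le_of_tendsto hw.norm ?_
      filter_upwards [hev'] with i hi
      exact hi w hwmem
    have hcover : (Iio (0 : ℝ) ×ˢ (univ : Set (EuclideanSpace ℝ (Fin 3)))) ⊆
        ⋃ m : ℕ, parabolicCylinder ((2 : ℝ) ^ m) (0 : ℝ × (EuclideanSpace ℝ (Fin 3))) := by
      rintro ⟨t, x⟩ ⟨ht', -⟩
      obtain ⟨m, hm⟩ := exists_mem_parabolicCylinder_two_pow₃ (mem_Iio.1 ht') x
      exact mem_iUnion.2 ⟨m, hm⟩
    exact ae_restrict_of_ae_restrict_of_subset hcover ((ae_restrict_iUnion_iff _ _).2 hQ)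
  -- ## representatives: the rate everywhere, then continuous Oseen-mild (KNSS)
  obtain ⟨U₁, hae₁, hdec₁⟩ := exists_repr_hasTypeITimeDecay hM hrate_ae
  have hae₁' : ∀ᵐ w ∂(volume.restrict ((slab (EuclideanSpace ℝ (Fin 3)) (Iio 0) isOpen_Iio :
      TopologicalSpace.Opens (ℝ × (EuclideanSpace ℝ (Fin 3)))) : Set (ℝ × (EuclideanSpace ℝ (Fin 3))))), Function.uncurry Ut w = Function.uncurry U₁ w := by
    rw [coe_slab]
    exact hae₁
  have hsw₁ : IsSuitableWeakSolutionOn (slab (EuclideanSpace ℝ (Fin 3)) (Iio 0) isOpen_Iio) 1 0 U₁ Pt :=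
    hswU.congr_ae hae₁' (ae_of_all _ fun _ => rfl)
  have hI₁ : typeIBound (Iio (0 : ℝ) ×ˢ univ) U₁ Pt Ht < ⊤ := by
    rwa [← typeIBound_congr_ae hae₁]
  obtain ⟨U', hae₂, hUc, hUdiv, hUmild, hUrate⟩ :=
    exists_oseenMild_repr_of_typeIBound_lt_top hsw₁ hdec₁ hI₁
  have hae : ∀ᵐ w ∂(volume.restrict (Iio (0 : ℝ) ×ˢ (univ : Set (EuclideanSpace ℝ (Fin 3))))),
      Function.uncurry Ut w = Function.uncurry U' w := by
    filter_upwards [hae₁, hae₂] with w h1 h2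
    rw [h1, h2]
  have hae' : ∀ᵐ w ∂(volume.restrict ((slab (EuclideanSpace ℝ (Fin 3)) (Iio 0) isOpen_Iio :
      TopologicalSpace.Opens (ℝ × (EuclideanSpace ℝ (Fin 3)))) : Set (ℝ × (EuclideanSpace ℝ (Fin 3))))), Function.uncurry Ut w = Function.uncurry U' w := by
    rw [coe_slab]
    exact hae
  have hTI : IsTypeIAncientMild M U' :=
    LocalTypeIBlowup.isTypeIAncientMild_of_continuous_oseenMild_rate hUc hUdiv hUmild hUrate
  have hIBU' : ∀ a : ℝ, 0 < a → IsSuitableWeakSolutionInBall a (0 : ℝ × (EuclideanSpace ℝ (Fin 3))) U' Pt := fun a ha =>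
    (hIBU a ha).congr_ae'
      (ae_restrict_of_ae_restrict_of_subset (parabolicCylinder_origin_subset_slab a) hae)
      (ae_of_all _ fun _ => rfl)
  have hHU' : HasWeakSpatialGradientOn (slab (EuclideanSpace ℝ (Fin 3)) (Iio 0) isOpen_Iio) U' Ht := hHU.congr_ae hae'
  have hIU' : typeIBound (Iio (0 : ℝ) ×ˢ univ) U' Pt Ht < ⊤ := by
    rw [← typeIBound_congr_ae hae]
    exact h4Itop
  -- ## the envelope everywhere on the open past (continuity of the representative)
  have henv' : ∀ᵐ w ∂(volume.restrict (Iio (0 : ℝ) ×ˢ (univ : Set (EuclideanSpace ℝ (Fin 3))))),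
      ‖Function.uncurry U' w‖ ≤ A / (‖w.2‖ + Real.sqrt (-w.1)) := by
    filter_upwards [henv_ae, hae] with w h1 h2
    rw [← h2]
    exact h1
  have hgc : ContinuousOn (fun w : ℝ × (EuclideanSpace ℝ (Fin 3)) => A / (‖w.2‖ + Real.sqrt (-w.1)))
      (Iio (0 : ℝ) ×ˢ (univ : Set (EuclideanSpace ℝ (Fin 3)))) := by
    refine ContinuousOn.div continuousOn_const
      (continuous_snd.norm.add (continuous_fst.neg.sqrt)).continuousOn ?_
    rintro ⟨s, y⟩ ⟨hs, -⟩
    exact (add_pos_of_nonneg_of_pos (norm_nonneg _)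
      (Real.sqrt_pos.2 (neg_pos.2 (mem_Iio.1 hs)))).ne'
  have hdecay : HasTypeIDecay A U' := by
    intro t ht' x
    have h1 := norm_le_of_ae_le_of_continuousOn (isOpen_Iio.prod isOpen_univ) hUc hgc henv' (t, x)
      ⟨mem_Iio.2 ht', mem_univ _⟩
    simpa using h1
  refine ⟨U', Pt, Ht, ⟨hTI, hIBU', hHU', hIU'⟩, hdecay, fun R hR => ?_⟩
  -- ## identification with the tangent flow on `Q_R(0)`, `R < 1`
  obtain ⟨hR0, hR1⟩ := hR
  obtain ⟨-, hŪmem, hconvŪ, -⟩ := hTR R ⟨hR0, hR1⟩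
  have hsubR : parabolicCylinder R (0 : ℝ × (EuclideanSpace ℝ (Fin 3))) ⊆ parabolicCylinder ((2 : ℝ) ^ 0) (0 : ℝ × (EuclideanSpace ℝ (Fin 3))) :=
    parabolicCylinder_mono hR0.le (by rw [pow_zero]; exact hR1.le) _
  have hμR : volume.restrict (parabolicCylinder R (0 : ℝ × (EuclideanSpace ℝ (Fin 3)))) ≤
      volume.restrict (parabolicCylinder ((2 : ℝ) ^ 0) (0 : ℝ × (EuclideanSpace ℝ (Fin 3)))) :=
    Measure.restrict_mono hsubR le_rfl
  have hmeasv : ∀ j, AEStronglyMeasurable (Function.uncurry (v (σ j)))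
      (volume.restrict (parabolicCylinder R (0 : ℝ × (EuclideanSpace ℝ (Fin 3))))) := fun j =>
    ((hballs 0 (σ j)).1.distributional.1.aestronglyMeasurable).mono_measure hμR
  have h1 : Tendsto (fun j => eLpNorm (Function.uncurry (v (σ j)) - Function.uncurry Ū) 3
      (volume.restrict (parabolicCylinder R (0 : ℝ × (EuclideanSpace ℝ (Fin 3)))))) atTop (𝓝 0) :=
    hconvŪ.comp hσ.tendsto_atTop
  have hae3 : Function.uncurry Ū =ᵐ[volume.restrict (parabolicCylinder R (0 : ℝ × (EuclideanSpace ℝ (Fin 3))))] Function.uncurry Ut :=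
    ae_eq_of_tendsto_eLpNorm_three hmeasv hŪmem.1 (hmemU R hR0).1 h1 (hconvU R hR0)
  have hae4 : ∀ᵐ w ∂(volume.restrict (parabolicCylinder R (0 : ℝ × (EuclideanSpace ℝ (Fin 3))))),
      Function.uncurry Ut w = Function.uncurry U' w :=
    ae_restrict_of_ae_restrict_of_subset (parabolicCylinder_origin_subset_slab R) hae
  filter_upwards [hae3, hae4] with w h3 h4
  exact h3.trans h4

end Tower

end Summit.NavierStokesRegularity.NavierStokesRegularity.Cruxes.ScarEnvelopeTypeI.ZoomDictionary
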